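import Summits.ResolutionOfSingularities.ResolutionOfSingularities.Theorems.FrobeniusLadderFInjectiveMacaulayficationWildPinchClosedCentre
import HarnessLib

/-!
# The LINE-CENTRE ENGINE for surfaces (and hypersurfaces) in `𝔸³`: #4β along a coordinate line from two chart certificates
# (crux `FInjectiveMacaulayfication` stmt-ResolutionOfSingularities-15315, chain w45a, door v30; line WFix under #4β)

[OURS · L1 W4.5a · res-L1-w45a-lead-1 gen 5] Support file (`--supports stmt-ResolutionOfSingularities-15315 --as helper`); NOT a
statement of any manuscript; AI-written, weaker than expert review.

The wild-pinch certificate `WildPinchClosedCentre.closedCentreExists_wildPinch` (p547758) with the specimen replaced by PARAMETERS.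
Data: a field `k` of characteristic `p`, a prime `f ∈ k[X₀,X₁,X₂]` dividing neither `X₀` nor `X₂`, and for each of the two charts
`c` of the blowing up of `𝔸³` along the line `X₀ = X₂ = 0` (`WildPinchClosedCentre.Fan02of3`: chart `0` is `X₂ ↦ X₀X₂`, chart `1`
is `X₀ ↦ X₂X₀`) a factorisation `θ_c f = X_{jc c}^{μ c} · g_c` with no variable dividing `g_c` (the strict transforms).
Certificates: (on) every local ring of `k[X]/(g_c)` at a maximal ideal containing `X̄_{jc c}` (a closed point of the exceptional
divisor) satisfies the crux clause; (off) every local ring of `R̄ = k[X]/(f)` at a maximal ideal not containing `(X̄₀, X̄₂)`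
satisfies it. Conclusions:

* `chart_clause_of_hon` — (on) transported to the Rees chart ring `R̄[I/X̄_{jc c}]` along the (C1) presentation
  (`MonomialChartPresentationKernel`), the exceptional condition `X̄_{jc c}/1 ∈ Q` matched with `X̄_{jc c} ∈ Q'` through
  `θ_c(X_{jc c}) = X_{jc c}`;
* `affineBlowup_full` — EVERY stalk of `Bl_{(X̄₀,X̄₂)} Spec R̄` is a domain satisfying the clause
  (`BlowupFiModelOfCoverOverClosed.blowupClause_over_closed`, `𝔟 = 0`);
* `closedCentreExists_of_charts` / `closedCentreExists_of_charts_bad` — the #4β package: `J = (X̄₀, X̄₂)~ ≠ ⊥`, every `b ∈ V(J)`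
  (in particular every closed BAD point, which lies on `V(J)` by (off)) is in `supp J`, and every blowing up along `J` is FULL at
  every point (`IsBlowupStalkTransfer`).

So a further surface specimen with a coordinate-line centre costs two strict transforms and two Jacobian facts. [folklore
mathematics; OURS as glue]
-/

-- single-problem summit: the doubled namespace component is forced
set_option linter.dupNamespace false

noncomputable section

namespace Summit.ResolutionOfSingularities.ResolutionOfSingularities.Theorems.FInjectiveMacaulayfication.LineCentreEngine

open AlgebraicGeometry CategoryTheory Literature.AlgebraicGeometry.Resolution MvPolynomial
open Summit.ResolutionOfSingularities.ResolutionOfSingularities.Theorems.FInjectiveMacaulayfication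
open Summit.ResolutionOfSingularities.ResolutionOfSingularities.Theorems.FInjectiveMacaulayfication.WildPinchClosedCentre

/-! ## §1 Two more facts about the fan `Fan02of3` -/

/-- **`hunit`** for an arbitrary exceptional multiplicity `μ`: `(2μ) • m c = ∑ j, (μ e_{jc c}) j • a c j + 0`. [table check] -/
theorem hunit_mu (μ : ℕ) : ∀ c : Fin 2, ∃ (N : ℕ) (r' : Fin 3 →₀ ℕ),
    N • Fan02of3.m c = ∑ j : Fin 3, (Finsupp.single (Fan02of3.jc c) μ : Fin 3 →₀ ℕ) j • Fan02of3.a c j + r' := by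
  intro c
  refine ⟨2 * μ, 0, ?_⟩
  rw [add_zero]
  rw [Finset.sum_eq_single (Fan02of3.jc c) (fun j _ hj => by rw [Finsupp.single_eq_of_ne hj, zero_smul])
    (fun h => absurd (Finset.mem_univ _) h), Finsupp.single_eq_same]
  ext j
  simp only [Fan02of3.m, Fan02of3.a, Finsupp.smul_apply, Finsupp.coe_equivFunOnFinite_symm, smul_eq_mul, Fan02of3.two_table c j]
  ring

/-- The chart substitution fixes the inverted variable: `θ_c (X_{jc c}) = X_{jc c}`. [table check] -/
theorem theta_X_jc (k : Type) [Field k] : ∀ c : Fin 2,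
    (∏ i : Fin 3, (X i : MvPolynomial (Fin 3) k) ^ Fan02of3.V c i (Fan02of3.jc c)) = X (Fan02of3.jc c) := by
  intro c
  fin_cases c
  · simp [Fin.prod_univ_three, Fan02of3.V, Fan02of3.jc]
  · simp [Fin.prod_univ_three, Fan02of3.V, Fan02of3.jc]

/-- `x̄^{m c} = X̄_{jc c}`. -/
theorem mk_monomial_m (k : Type) [Field k] (F : Ideal (MvPolynomial (Fin 3) k)) (c : Fin 2) :
    Ideal.Quotient.mk F (monomial (Fan02of3.m c) (1 : k)) = Ideal.Quotient.mk F (X (Fan02of3.jc c)) := by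
  rw [Fan02of3.m_eq_single, ← X_pow_eq_monomial, pow_one]

/-! ## §2 The chart certificate transported to the Rees chart -/

set_option maxHeartbeats 800000 in
/-- **(on), transported.** `θ_c f = X_{jc c}^{μ}·g` with no variable dividing `g`; if every local ring of `k[X]/(g)` at a maximal ideal
containing `X̄_{jc c}` satisfies the clause, then so does every local ring of the Rees chart ring `R̄[I_A/x̄^{m c}]` at a maximal ideal
containing `x̄^{m c}/1` ((C1) presentation; `θ_c X_{jc c} = X_{jc c}` matches the two exceptional conditions). [folklore] -/
theorem chart_clause_of_hon (p : ℕ) [Fact p.Prime] (k : Type) [Field k] [CharP k p] (f : MvPolynomial (Fin 3) k) (c : Fin 2)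
    (μ : ℕ) (g : MvPolynomial (Fin 3) k)
    (hg : aeval (fun j : Fin 3 => ∏ i : Fin 3, (X i : MvPolynomial (Fin 3) k) ^ Fan02of3.V c i j) f =
      monomial (Finsupp.single (Fan02of3.jc c) μ) (1 : k) * g)
    (hcop : ∀ i : Fin 3, ¬ (X i ∣ g))
    (hon : ∀ (Q' : Ideal (MvPolynomial (Fin 3) k ⧸ Ideal.span {g})) [Q'.IsMaximal],
      Ideal.Quotient.mk (Ideal.span {g}) (X (Fan02of3.jc c)) ∈ Q' →
      ∀ d : ℕ, ringKrullDim (Localization.AtPrime Q') = d → ∀ s : Fin d → Localization.AtPrime Q',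
        (Ideal.span (Set.range s)).radical.IsMaximal →
          RingTheory.Sequence.IsWeaklyRegular (Localization.AtPrime Q') (List.ofFn s) ∧
          ∀ y : Localization.AtPrime Q', (∃ e : ℕ, y ^ p ^ e ∈ Ideal.span
            ((fun z : Localization.AtPrime Q' => z ^ p ^ e) ''
              (Ideal.span (Set.range s) : Set (Localization.AtPrime Q')))) → y ∈ Ideal.span (Set.range s))
    (Q : Ideal ↥(Literature.AlgebraicGeometry.Resolution.blowupAlgebra
      (Ideal.span ((fun e : Fin 3 →₀ ℕ => Ideal.Quotient.mk (Ideal.span {f}) (monomial e (1 : k))) '' (Fan02of3.A : Set (Fin 3 →₀ ℕ))))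
      (Ideal.Quotient.mk (Ideal.span {f}) (monomial (Fan02of3.m c) (1 : k))))) [Q.IsMaximal]
    (hvQ : algebraMap (MvPolynomial (Fin 3) k ⧸ Ideal.span {f}) _ (Ideal.Quotient.mk (Ideal.span {f}) (monomial (Fan02of3.m c) (1 : k))) ∈ Q) :
    ∀ d : ℕ, ringKrullDim (Localization.AtPrime Q) = d → ∀ s : Fin d → Localization.AtPrime Q,
      (Ideal.span (Set.range s)).radical.IsMaximal →
        RingTheory.Sequence.IsWeaklyRegular (Localization.AtPrime Q) (List.ofFn s) ∧
        ∀ y : Localization.AtPrime Q, (∃ e : ℕ, y ^ p ^ e ∈ Ideal.span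
          ((fun z : Localization.AtPrime Q => z ^ p ^ e) ''
            (Ideal.span (Set.range s) : Set (Localization.AtPrime Q)))) → y ∈ Ideal.span (Set.range s) := by
  have H := MonomialChartPresentationKernel.exists_monomialChartPresentation f (Fan02of3.V c) (Fan02of3.hV c)
    (Fan02of3.m c) (Fan02of3.a c) (Fan02of3.hgen c) Fan02of3.A (Fan02of3.haA c) (Fan02of3.hge c)
    (Finsupp.single (Fan02of3.jc c) μ) g hg (hunit_mu μ c) hcop
  obtain ⟨e, hrest⟩ := H
  let ε := RingEquiv.ofBijective e hrest.1
  haveI hQ' : (Q.comap ε.toRingHom).IsMaximal := Ideal.comap_isMaximal_of_surjective _ ε.surjective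
  -- `ε (X̄_{jc c}) = x̄^{m c}/1`, so the exceptional conditions match
  have h3 := hrest.2.2 (X (Fan02of3.jc c))
  rw [aeval_X, theta_X_jc k c] at h3
  have hmem : Ideal.Quotient.mk (Ideal.span {g}) (X (Fan02of3.jc c)) ∈ Q.comap ε.toRingHom := by
    rw [Ideal.mem_comap]
    have hεeq : ε.toRingHom (Ideal.Quotient.mk (Ideal.span {g}) (X (Fan02of3.jc c))) =
        algebraMap (MvPolynomial (Fin 3) k ⧸ Ideal.span {f}) _ (Ideal.Quotient.mk (Ideal.span {f}) (monomial (Fan02of3.m c) (1 : k))) := by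
      apply Subtype.ext
      rw [Subalgebra.coe_algebraMap]
      refine h3.trans ?_
      congr 1
      exact (mk_monomial_m k _ c).symm
    rw [hεeq]
    exact hvQ
  have hcl := hon (Q.comap ε.toRingHom) hmem
  obtain ⟨eloc⟩ := E8Char5FiModel.nonempty_ringEquiv_localization_comap ε Q
  exact DegreeZeroDescent.inlineClause_of_ringEquiv p eloc hcl

/-! ## §3 Every stalk of `Bl_{(X̄₀, X̄₂)} Spec R̄` is FULL -/

set_option maxHeartbeats 800000 in
/-- **EVERY STALK OF `Bl_{(X̄₀,X̄₂)} Spec k[X]/(f)` IS A DOMAIN SATISFYING THE CRUX CLAUSE**, from the two chart certificates (on) and the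
base certificate (off); centre in the fan form `I = I_A R̄` (`= (X̄₀, X̄₂)` by `WildPinchClosedCentre.centre_eq_span_pair`). Glue
`BlowupFiModelOfCoverOverClosed.blowupClause_over_closed` with `𝔟 = 0`, cover `T11Char3Frame.reesCover_of_fanCover`. [folklore] -/
theorem affineBlowup_full (p : ℕ) [Fact p.Prime] (k : Type) [Field k] [CharP k p] (f : MvPolynomial (Fin 3) k)
    (hprime : Prime f) (hX : ∀ c : Fin 2, ¬ (f ∣ X (Fan02of3.jc c)))
    (μ : Fin 2 → ℕ) (g : Fin 2 → MvPolynomial (Fin 3) k)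
    (hg : ∀ c : Fin 2, aeval (fun j : Fin 3 => ∏ i : Fin 3, (X i : MvPolynomial (Fin 3) k) ^ Fan02of3.V c i j) f =
      monomial (Finsupp.single (Fan02of3.jc c) (μ c)) (1 : k) * g c)
    (hcop : ∀ (c : Fin 2) (i : Fin 3), ¬ (X i ∣ g c))
    (hon : ∀ (c : Fin 2) (Q' : Ideal (MvPolynomial (Fin 3) k ⧸ Ideal.span {g c})) [Q'.IsMaximal],
      Ideal.Quotient.mk (Ideal.span {g c}) (X (Fan02of3.jc c)) ∈ Q' →
      ∀ d : ℕ, ringKrullDim (Localization.AtPrime Q') = d → ∀ s : Fin d → Localization.AtPrime Q',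
        (Ideal.span (Set.range s)).radical.IsMaximal →
          RingTheory.Sequence.IsWeaklyRegular (Localization.AtPrime Q') (List.ofFn s) ∧
          ∀ y : Localization.AtPrime Q', (∃ e : ℕ, y ^ p ^ e ∈ Ideal.span
            ((fun z : Localization.AtPrime Q' => z ^ p ^ e) ''
              (Ideal.span (Set.range s) : Set (Localization.AtPrime Q')))) → y ∈ Ideal.span (Set.range s))
    (hoff : ∀ (Q : Ideal (MvPolynomial (Fin 3) k ⧸ Ideal.span {f})) [Q.IsMaximal],
      ¬ Ideal.span {Ideal.Quotient.mk (Ideal.span {f}) (X 0), Ideal.Quotient.mk (Ideal.span {f}) (X 2)} ≤ Q →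
      ∀ d : ℕ, ringKrullDim (Localization.AtPrime Q) = d → ∀ s : Fin d → Localization.AtPrime Q,
        (Ideal.span (Set.range s)).radical.IsMaximal →
          RingTheory.Sequence.IsWeaklyRegular (Localization.AtPrime Q) (List.ofFn s) ∧
          ∀ y : Localization.AtPrime Q, (∃ e : ℕ, y ^ p ^ e ∈ Ideal.span
            ((fun z : Localization.AtPrime Q => z ^ p ^ e) ''
              (Ideal.span (Set.range s) : Set (Localization.AtPrime Q)))) → y ∈ Ideal.span (Set.range s))
    (I : Ideal (MvPolynomial (Fin 3) k ⧸ Ideal.span {f}))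
    (hI : I = Ideal.span ((fun e : Fin 3 →₀ ℕ => Ideal.Quotient.mk (Ideal.span {f}) (monomial e (1 : k))) ''
      (Fan02of3.A : Set (Fin 3 →₀ ℕ)))) :
    ∀ y : ↥(affineBlowup I), IsDomain ((affineBlowup I).presheaf.stalk y) ∧
      ∀ d : ℕ, ringKrullDim ((affineBlowup I).presheaf.stalk y) = d →
        ∀ s : Fin d → (affineBlowup I).presheaf.stalk y, (Ideal.span (Set.range s)).radical.IsMaximal →
          RingTheory.Sequence.IsWeaklyRegular ((affineBlowup I).presheaf.stalk y) (List.ofFn s) ∧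
          ∀ z : (affineBlowup I).presheaf.stalk y, (∃ e : ℕ, z ^ p ^ e ∈
              Ideal.span ((fun w : (affineBlowup I).presheaf.stalk y => w ^ p ^ e) ''
                (Ideal.span (Set.range s) : Set ((affineBlowup I).presheaf.stalk y)))) →
            z ∈ Ideal.span (Set.range s) := by
  subst hI
  haveI hdom : IsDomain (MvPolynomial (Fin 3) k ⧸ Ideal.span {f}) :=
    (Ideal.Quotient.isDomain_iff_prime _).mpr ((Ideal.span_singleton_prime hprime.ne_zero).mpr hprime)
  haveI : CharP (MvPolynomial (Fin 3) k ⧸ Ideal.span {f}) p :=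
    charP_of_injective_algebraMap (algebraMap k (MvPolynomial (Fin 3) k ⧸ Ideal.span {f})).injective p
  have hv : ∀ c : Fin 2, Ideal.Quotient.mk (Ideal.span {f}) (monomial (Fan02of3.m c) (1 : k)) ∈
      Ideal.span ((fun e : Fin 3 →₀ ℕ => Ideal.Quotient.mk (Ideal.span {f}) (monomial e (1 : k))) '' (Fan02of3.A : Set (Fin 3 →₀ ℕ))) :=
    fun c => Ideal.subset_span ⟨Fan02of3.m c, Fan02of3.hmA c, rfl⟩
  have hv0 : ∀ c : Fin 2, Ideal.Quotient.mk (Ideal.span {f}) (monomial (Fan02of3.m c) (1 : k)) ≠ 0 := by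
    intro c
    rw [mk_monomial_m, Ne, Ideal.Quotient.eq_zero_iff_mem, Ideal.mem_span_singleton]
    exact hX c
  intro y
  refine BlowupFiModelOfCoverOverClosed.blowupClause_over_closed p (MvPolynomial (Fin 3) k ⧸ Ideal.span {f}) _ 2
    (fun c => Ideal.Quotient.mk (Ideal.span {f}) (monomial (Fan02of3.m c) (1 : k))) hv hv0
    (T11Char3Frame.reesCover_of_fanCover f Fan02of3.A Fan02of3.m Fan02of3.hmA (Fan02of3.hcov k)) ⊥ ?_ ?_ y bot_le
  · intro Q hQ hIQ _
    refine hoff Q ?_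
    rwa [← centre_eq_span_pair k f]
  · intro c Q hQ hvQ _
    exact chart_clause_of_hon p k f c (μ c) (g c) (hg c) (hcop c) (hon c) Q hvQ

/-! ## §4 The #4β package -/

/-- **#4β ALONG THE LINE, from the chart certificates**: for `R̄ = k[X₀,X₁,X₂]/(f)` as in `affineBlowup_full` and `I = (X̄₀, X̄₂)`,
`J := Ĩ ≠ ⊥`, every `b ∈ V(I)` lies in `supp J`, and EVERY blowing up of `Spec R̄` along `J` is FULL at EVERY point over `supp J`
(indeed at every point). [folklore mathematics; OURS as glue] -/
theorem closedCentreExists_of_charts (p : ℕ) [Fact p.Prime] (k : Type) [Field k] [CharP k p] (f : MvPolynomial (Fin 3) k)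
    (hprime : Prime f) (hX : ∀ c : Fin 2, ¬ (f ∣ X (Fan02of3.jc c)))
    (μ : Fin 2 → ℕ) (g : Fin 2 → MvPolynomial (Fin 3) k)
    (hg : ∀ c : Fin 2, aeval (fun j : Fin 3 => ∏ i : Fin 3, (X i : MvPolynomial (Fin 3) k) ^ Fan02of3.V c i j) f =
      monomial (Finsupp.single (Fan02of3.jc c) (μ c)) (1 : k) * g c)
    (hcop : ∀ (c : Fin 2) (i : Fin 3), ¬ (X i ∣ g c))
    (hon : ∀ (c : Fin 2) (Q' : Ideal (MvPolynomial (Fin 3) k ⧸ Ideal.span {g c})) [Q'.IsMaximal],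
      Ideal.Quotient.mk (Ideal.span {g c}) (X (Fan02of3.jc c)) ∈ Q' →
      ∀ d : ℕ, ringKrullDim (Localization.AtPrime Q') = d → ∀ s : Fin d → Localization.AtPrime Q',
        (Ideal.span (Set.range s)).radical.IsMaximal →
          RingTheory.Sequence.IsWeaklyRegular (Localization.AtPrime Q') (List.ofFn s) ∧
          ∀ y : Localization.AtPrime Q', (∃ e : ℕ, y ^ p ^ e ∈ Ideal.span
            ((fun z : Localization.AtPrime Q' => z ^ p ^ e) ''
              (Ideal.span (Set.range s) : Set (Localization.AtPrime Q')))) → y ∈ Ideal.span (Set.range s))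
    (hoff : ∀ (Q : Ideal (MvPolynomial (Fin 3) k ⧸ Ideal.span {f})) [Q.IsMaximal],
      ¬ Ideal.span {Ideal.Quotient.mk (Ideal.span {f}) (X 0), Ideal.Quotient.mk (Ideal.span {f}) (X 2)} ≤ Q →
      ∀ d : ℕ, ringKrullDim (Localization.AtPrime Q) = d → ∀ s : Fin d → Localization.AtPrime Q,
        (Ideal.span (Set.range s)).radical.IsMaximal →
          RingTheory.Sequence.IsWeaklyRegular (Localization.AtPrime Q) (List.ofFn s) ∧
          ∀ y : Localization.AtPrime Q, (∃ e : ℕ, y ^ p ^ e ∈ Ideal.span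
            ((fun z : Localization.AtPrime Q => z ^ p ^ e) ''
              (Ideal.span (Set.range s) : Set (Localization.AtPrime Q)))) → y ∈ Ideal.span (Set.range s))
    (I : Ideal (MvPolynomial (Fin 3) k ⧸ Ideal.span {f}))
    (hI : I = Ideal.span {Ideal.Quotient.mk (Ideal.span {f}) (X 0), Ideal.Quotient.mk (Ideal.span {f}) (X 2)})
    (b : ↥(Spec (.of (MvPolynomial (Fin 3) k ⧸ Ideal.span {f})))) (hb : I ≤ b.asIdeal) :
    ∃ J : (Spec (.of (MvPolynomial (Fin 3) k ⧸ Ideal.span {f}))).IdealSheafData, J ≠ ⊥ ∧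
      b ∈ (J.support : Set ↥(Spec (.of (MvPolynomial (Fin 3) k ⧸ Ideal.span {f})))) ∧
      ∀ (X' : Scheme.{0}) (π : X' ⟶ Spec (.of (MvPolynomial (Fin 3) k ⧸ Ideal.span {f}))),
        Literature.AlgebraicGeometry.Resolution.IsBlowup π J →
        ∀ x' : X', π.base x' ∈ (J.support : Set ↥(Spec (.of (MvPolynomial (Fin 3) k ⧸ Ideal.span {f})))) →
          IsDomain (X'.presheaf.stalk x') ∧ ∀ d : ℕ, ringKrullDim (X'.presheaf.stalk x') = d →
            ∀ s : Fin d → X'.presheaf.stalk x', (Ideal.span (Set.range s)).radical.IsMaximal →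
              RingTheory.Sequence.IsWeaklyRegular (X'.presheaf.stalk x') (List.ofFn s) ∧
              ∀ z : X'.presheaf.stalk x', (∃ e : ℕ, z ^ p ^ e ∈
                  Ideal.span ((fun w : X'.presheaf.stalk x' => w ^ p ^ e) ''
                    (Ideal.span (Set.range s) : Set (X'.presheaf.stalk x')))) → z ∈ Ideal.span (Set.range s) := by
  have hIA : I = Ideal.span ((fun e : Fin 3 →₀ ℕ => Ideal.Quotient.mk (Ideal.span {f}) (monomial e (1 : k))) ''
      (Fan02of3.A : Set (Fin 3 →₀ ℕ))) := hI.trans (centre_eq_span_pair k f).symm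
  have hI0 : I ≠ ⊥ := by
    intro h0
    have hmem : Ideal.Quotient.mk (Ideal.span {f}) (X 0) ∈ I := hI ▸ Ideal.subset_span (Set.mem_insert _ _)
    rw [h0, Ideal.mem_bot, Ideal.Quotient.eq_zero_iff_mem, Ideal.mem_span_singleton] at hmem
    exact hX 0 hmem
  refine ⟨affineBlowup.idealSheaf I, affineBlowup.idealSheaf_ne_bot hI0,
    (FCForallExistsCylinder.mem_support_idealSheaf_iff I b).mpr hb, fun X' π hπ x' _ => ?_⟩
  obtain ⟨x'', -, ⟨e⟩⟩ := IsBlowupStalkTransfer.stub_isBlowupStalkTransfer _ _ _ _ π (affineBlowup.π I) hπ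
    (affineBlowup.isBlowup I) x'
  obtain ⟨hdom, hcl⟩ := affineBlowup_full p k f hprime hX μ g hg hcop hon hoff I hIA x''
  haveI := hdom
  exact ⟨MulEquiv.isDomain _ e.toMulEquiv,
    DegreeZeroDescent.inlineClause_of_ringEquiv p (L := (affineBlowup I).presheaf.stalk x'') (L' := X'.presheaf.stalk x') e.symm hcl⟩

/-- **#4β AT EVERY CLOSED BAD POINT, from the chart certificates** — the body of door v30's `stub_closedCentreExists` for `X₁ = Spec R̄`:
a closed point `b` with a non-Frobenius-closed parameter ideal lies on `V(X̄₀, X̄₂)` by (off) (moved to the stalk along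
`Spec.stalkIso`), where `closedCentreExists_of_charts` applies. [folklore mathematics; OURS as glue] -/
theorem closedCentreExists_of_charts_bad (p : ℕ) [Fact p.Prime] (k : Type) [Field k] [CharP k p] (f : MvPolynomial (Fin 3) k)
    (hprime : Prime f) (hX : ∀ c : Fin 2, ¬ (f ∣ X (Fan02of3.jc c)))
    (μ : Fin 2 → ℕ) (g : Fin 2 → MvPolynomial (Fin 3) k)
    (hg : ∀ c : Fin 2, aeval (fun j : Fin 3 => ∏ i : Fin 3, (X i : MvPolynomial (Fin 3) k) ^ Fan02of3.V c i j) f =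
      monomial (Finsupp.single (Fan02of3.jc c) (μ c)) (1 : k) * g c)
    (hcop : ∀ (c : Fin 2) (i : Fin 3), ¬ (X i ∣ g c))
    (hon : ∀ (c : Fin 2) (Q' : Ideal (MvPolynomial (Fin 3) k ⧸ Ideal.span {g c})) [Q'.IsMaximal],
      Ideal.Quotient.mk (Ideal.span {g c}) (X (Fan02of3.jc c)) ∈ Q' →
      ∀ d : ℕ, ringKrullDim (Localization.AtPrime Q') = d → ∀ s : Fin d → Localization.AtPrime Q',
        (Ideal.span (Set.range s)).radical.IsMaximal →
          RingTheory.Sequence.IsWeaklyRegular (Localization.AtPrime Q') (List.ofFn s) ∧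
          ∀ y : Localization.AtPrime Q', (∃ e : ℕ, y ^ p ^ e ∈ Ideal.span
            ((fun z : Localization.AtPrime Q' => z ^ p ^ e) ''
              (Ideal.span (Set.range s) : Set (Localization.AtPrime Q')))) → y ∈ Ideal.span (Set.range s))
    (hoff : ∀ (Q : Ideal (MvPolynomial (Fin 3) k ⧸ Ideal.span {f})) [Q.IsMaximal],
      ¬ Ideal.span {Ideal.Quotient.mk (Ideal.span {f}) (X 0), Ideal.Quotient.mk (Ideal.span {f}) (X 2)} ≤ Q →
      ∀ d : ℕ, ringKrullDim (Localization.AtPrime Q) = d → ∀ s : Fin d → Localization.AtPrime Q,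
        (Ideal.span (Set.range s)).radical.IsMaximal →
          RingTheory.Sequence.IsWeaklyRegular (Localization.AtPrime Q) (List.ofFn s) ∧
          ∀ y : Localization.AtPrime Q, (∃ e : ℕ, y ^ p ^ e ∈ Ideal.span
            ((fun z : Localization.AtPrime Q => z ^ p ^ e) ''
              (Ideal.span (Set.range s) : Set (Localization.AtPrime Q)))) → y ∈ Ideal.span (Set.range s))
    (b : ↥(Spec (.of (MvPolynomial (Fin 3) k ⧸ Ideal.span {f}))))
    (hb : IsClosed ({b} : Set ↥(Spec (.of (MvPolynomial (Fin 3) k ⧸ Ideal.span {f})))))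
    (hbad : ¬ ∀ d : ℕ, ringKrullDim ((Spec (.of (MvPolynomial (Fin 3) k ⧸ Ideal.span {f}))).presheaf.stalk b) = d →
      ∀ s : Fin d → (Spec (.of (MvPolynomial (Fin 3) k ⧸ Ideal.span {f}))).presheaf.stalk b,
        (Ideal.span (Set.range s)).radical.IsMaximal →
          ∀ y : (Spec (.of (MvPolynomial (Fin 3) k ⧸ Ideal.span {f}))).presheaf.stalk b, (∃ e : ℕ, y ^ p ^ e ∈
            Ideal.span ((fun z : (Spec (.of (MvPolynomial (Fin 3) k ⧸ Ideal.span {f}))).presheaf.stalk b => z ^ p ^ e) ''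
              (Ideal.span (Set.range s) : Set ((Spec (.of (MvPolynomial (Fin 3) k ⧸ Ideal.span {f}))).presheaf.stalk b)))) →
            y ∈ Ideal.span (Set.range s)) :
    ∃ J : (Spec (.of (MvPolynomial (Fin 3) k ⧸ Ideal.span {f}))).IdealSheafData, J ≠ ⊥ ∧
      b ∈ (J.support : Set ↥(Spec (.of (MvPolynomial (Fin 3) k ⧸ Ideal.span {f})))) ∧
      ∀ (X' : Scheme.{0}) (π : X' ⟶ Spec (.of (MvPolynomial (Fin 3) k ⧸ Ideal.span {f}))),
        Literature.AlgebraicGeometry.Resolution.IsBlowup π J →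
        ∀ x' : X', π.base x' ∈ (J.support : Set ↥(Spec (.of (MvPolynomial (Fin 3) k ⧸ Ideal.span {f})))) →
          IsDomain (X'.presheaf.stalk x') ∧ ∀ d : ℕ, ringKrullDim (X'.presheaf.stalk x') = d →
            ∀ s : Fin d → X'.presheaf.stalk x', (Ideal.span (Set.range s)).radical.IsMaximal →
              RingTheory.Sequence.IsWeaklyRegular (X'.presheaf.stalk x') (List.ofFn s) ∧
              ∀ z : X'.presheaf.stalk x', (∃ e : ℕ, z ^ p ^ e ∈
                  Ideal.span ((fun w : X'.presheaf.stalk x' => w ^ p ^ e) ''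
                    (Ideal.span (Set.range s) : Set (X'.presheaf.stalk x')))) → z ∈ Ideal.span (Set.range s) := by
  by_cases hIb : Ideal.span {Ideal.Quotient.mk (Ideal.span {f}) (X 0), Ideal.Quotient.mk (Ideal.span {f}) (X 2)} ≤ b.asIdeal
  · exact closedCentreExists_of_charts p k f hprime hX μ g hg hcop hon hoff _ rfl b hIb
  · exfalso
    haveI : b.asIdeal.IsMaximal := (PrimeSpectrum.isClosed_singleton_iff_isMaximal b).mp hb
    have hcl := hoff b.asIdeal hIb
    let e : ((Spec (.of (MvPolynomial (Fin 3) k ⧸ Ideal.span {f}))).presheaf.stalk b) ≃+* Localization.AtPrime b.asIdeal :=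
      (Spec.stalkIso (.of (MvPolynomial (Fin 3) k ⧸ Ideal.span {f})) b).commRingCatIsoToRingEquiv
    have hcl' := DegreeZeroDescent.inlineClause_of_ringEquiv p (L := Localization.AtPrime b.asIdeal)
      (L' := (Spec (.of (MvPolynomial (Fin 3) k ⧸ Ideal.span {f}))).presheaf.stalk b) e.symm hcl
    exact hbad fun d hd s hs => (hcl' d hd s hs).2

end Summit.ResolutionOfSingularities.ResolutionOfSingularities.Theorems.FInjectiveMacaulayfication.LineCentreEngine
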